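import Summits.SmoothPoincare4.SmoothPoincare4.Theses.WeakReductionDescent
import Summits.SmoothPoincare4.SmoothPoincare4.Theorems.WeakReductionDescentWeakReductionReducesStubLoopDichotomyFromFiveCoreAux1
import Literature.Topology.FourManifolds.WeaklyReducibleTrisections
import Literature.Topology.FourManifolds.CircleSurgery

/-!
# Crux `WeakReductionReduces` (stmt-SmoothPoincare4-17908), line `loop_dichotomy`, stub CORE₅
# (`stub_loopDichotomyFromFiveCore`) — wave 2 (H2): CORE₅ follows from CORE₅⁺ (`1 ≤ k 0` added)

Registered helper `helper_loopDichotomyFromFiveCore_of_posFirst : CORE₅⁺ → CORE₅` (stub-add on the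
crux; lands `--supports stmt-SmoothPoincare4-17908`).  Pure logic over PROVED tree theorems; no
definition and no named fact is introduced.

CORE₅ (the registered stub `stub_loopDichotomyFromFiveCore` of skeleton v4, the hypothesis of the
wave-1 helper `helper_loopDichotomyFromFive_of_irreducibleCore`, `…StubLoopDichotomyFromFiveAux1.lean`)
is Aranda–Zupan's Theorem 1.3 (arXiv:2503.04607, genus three) one genus and more up, for homotopy
`4`-spheres, cut to its irreducible fixed-label core: a `(g; k₀, k₁, k₂)`-GK-trisection `T` of a
smooth homotopy `4`-sphere `M` with `g ≥ 5`, `Σ kᵢ = g`, all `kᵢ + 2 ≤ g`, NOT reducible, carrying a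
weak reduction with the labels fixed — `c` compressing in `H₀ = spineHandlebody T 0`, `c′` in
`H₁ = spineHandlebody T 1` and in `H₂ = spineHandlebody T 2` — admits a smaller-genus GK-trisection of
`M` or is a loop surgery on a smaller-genus trisected `X`.  CORE₅⁺ is the same statement with the
extra hypothesis `1 ≤ k 0` (inserted after `∀ i, k i + 2 ≤ g`).

**The cut.**  With the labels fixed, `c′` is a non-separating curve of the central surface bounding
compressing discs in `H₁` and in `H₂`, i.e. a non-separating reducing curve of the genus-`g`
Heegaard splitting `H₁ ∪_F H₂ = ∂(T 0) ≅ #^{k₀}(S¹ × S²)`; such a curve forces `k₀ ≥ 1`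
(Aranda–Zupan, §2 p. 6 and p. 21) — in the tree this is the structural lemma
`helper_one_le_kZero_of_doublyCompressing` (`…StubLoopDichotomyFromFiveCoreAux1.lean`, H1 of this
wave: the winding character of `c′` on `π₁(F)` kills both handlebody kernels, so lives on
`π₁(∂X₀) ≅ F_{k₀}` by (T2) + (T3), and is non-trivial on a dual loop).  Hence the sub-family
`k₀ = 0` of CORE₅ is vacuous and CORE₅ ⇐ CORE₅⁺.

## References

* R. Aranda, A. Zupan, *Manifolds with weakly reducible genus-three trisections are standard*,
  arXiv:2503.04607 (2025): Thm. 1.3 (p. 2), §2 (p. 6), p. 21. [ArandaZupan2025]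
* D. Gay, R. Kirby, *Trisecting 4-manifolds*, Geom. Topol. 20 (2016), Def. 1. [GayKirby2016]
-/

-- the registered namespace `Summit.SmoothPoincare4.SmoothPoincare4.Theorems…` repeats a component
set_option linter.dupNamespace false

noncomputable section

open scoped Manifold ContDiff Topology ContinuousMap
open Set
open Literature.Topology.FourManifolds Literature.Topology.FourManifolds.Trisection

namespace Summit.SmoothPoincare4.SmoothPoincare4.Theorems.WeakReductionReduces.LoopDichotomy

/-- **`helper_loopDichotomyFromFiveCore_of_posFirst` : CORE₅⁺ → CORE₅** (registered helper of crux
stmt-SmoothPoincare4-17908, line `loop_dichotomy`, stub `stub_loopDichotomyFromFiveCore`).  Given the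
hypotheses of CORE₅, the fixed-label weak reduction provides `c′`, non-separating on the central
surface and bounding compressing discs in `spineHandlebody T 1` and `spineHandlebody T 2`; the
structural lemma `helper_one_le_kZero_of_doublyCompressing` gives `1 ≤ k 0`, and CORE₅⁺ applies.
[cite: ArandaZupan2025, §2 (p. 6), Thm. 1.3 (p. 2)] [cite: GayKirby2016, Def. 1] -/
theorem helper_loopDichotomyFromFiveCore_of_posFirst :
    (∀ (M : Type) [TopologicalSpace M] [T2Space M] [SecondCountableTopology M] [ChartedSpace (EuclideanSpace ℝ (Fin 4)) M] [IsManifold (𝓡 4) ((⊤ : ℕ∞) : WithTop ℕ∞) M], (M ≃ₕ (Metric.sphere (0 : EuclideanSpace ℝ (Fin 5)) 1)) → ∀ (g : ℕ) (k : Fin 3 → ℕ) (T : Fin 3 → Set M), Literature.Topology.FourManifolds.IsGKTrisection M g k T → 5 ≤ g → k 0 + k 1 + k 2 = g → (∀ i, k i + 2 ≤ g) → 1 ≤ k 0 → (∃ c c' : Set M, Literature.Topology.FourManifolds.Trisection.IsCurve T c ∧ Literature.Topology.FourManifolds.Trisection.IsCurve T c' ∧ Disjoint c c' ∧ Literature.Topology.FourManifolds.Trisection.IsNonSeparating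 T c ∧ Literature.Topology.FourManifolds.Trisection.IsNonSeparating T c' ∧ Literature.Topology.FourManifolds.Trisection.BoundsDisc T (Literature.Topology.FourManifolds.Trisection.spineHandlebody T 0) c ∧ Literature.Topology.FourManifolds.Trisection.BoundsDisc T (Literature.Topology.FourManifolds.Trisection.spineHandlebody T 1) c' ∧ Literature.Topology.FourManifolds.Trisection.BoundsDisc T (Literature.Topology.FourManifolds.Trisection.spineHandlebody T 2) c') → ¬ Literature.Topology.FourManifolds.Trisection.IsReducible T → (∃ (g₁ : ℕ) (k₁ : Fin 3 → ℕ) (T₁ : Fin 3 → Set M), g₁ < g ∧ Literature.Topology.FourManifolds.IsGKTrisection M g₁ k₁ T₁) ∨ (∃ (X : Type) (_ : TopologicalSpace X) (_ : T2Space X) (_ : SecondCountableTopology X) (_ : ChartedSpace (EuclideanSpace ℝ (Fin 4)) X) (_ : IsManifold (𝓡 4) ((⊤ : ℕ∞) : WithTop ℕ∞) X) (g' : ℕ) (k' : Fin 3 → ℕ) (T' : Fin 3 → Set X) (ℓ : (Metric.sphere (0 : EuclideanSpace ℝ (Fin 2)) 1) → X), g' < g ∧ Literature.Topology.FourManifolds.IsGKTrisection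 X g' k' T' ∧ Manifold.IsSmoothEmbedding (𝓡 1) (𝓡 4) ((⊤ : ℕ∞) : WithTop ℕ∞) ℓ ∧ Literature.Topology.FourManifolds.IsCircleSurgery (𝓡 4) (𝓡 4) X M ℓ)) → ∀ (M : Type) [TopologicalSpace M] [T2Space M] [SecondCountableTopology M] [ChartedSpace (EuclideanSpace ℝ (Fin 4)) M] [IsManifold (𝓡 4) ((⊤ : ℕ∞) : WithTop ℕ∞) M], (M ≃ₕ (Metric.sphere (0 : EuclideanSpace ℝ (Fin 5)) 1)) → ∀ (g : ℕ) (k : Fin 3 → ℕ) (T : Fin 3 → Set M), Literature.Topology.FourManifolds.IsGKTrisection M g k T → 5 ≤ g → k 0 + k 1 + k 2 = g → (∀ i, k i + 2 ≤ g) → (∃ c c' : Set M, Literature.Topology.FourManifolds.Trisection.IsCurve T c ∧ Literature.Topology.FourManifolds.Trisection.IsCurve T c' ∧ Disjoint c c' ∧ Literature.Topology.FourManifolds.Trisection.IsNonSeparating T c ∧ Literature.Topology.FourManifolds.Trisection.IsNonSeparating T c' ∧ Literature.Topology.FourManifolds.Trisection.BoundsDisc T (Literature.Topology.FourManifolds.Trisection.spineHandlebody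 T 0) c ∧ Literature.Topology.FourManifolds.Trisection.BoundsDisc T (Literature.Topology.FourManifolds.Trisection.spineHandlebody T 1) c' ∧ Literature.Topology.FourManifolds.Trisection.BoundsDisc T (Literature.Topology.FourManifolds.Trisection.spineHandlebody T 2) c') → ¬ Literature.Topology.FourManifolds.Trisection.IsReducible T → (∃ (g₁ : ℕ) (k₁ : Fin 3 → ℕ) (T₁ : Fin 3 → Set M), g₁ < g ∧ Literature.Topology.FourManifolds.IsGKTrisection M g₁ k₁ T₁) ∨ (∃ (X : Type) (_ : TopologicalSpace X) (_ : T2Space X) (_ : SecondCountableTopology X) (_ : ChartedSpace (EuclideanSpace ℝ (Fin 4)) X) (_ : IsManifold (𝓡 4) ((⊤ : ℕ∞) : WithTop ℕ∞) X) (g' : ℕ) (k' : Fin 3 → ℕ) (T' : Fin 3 → Set X) (ℓ : (Metric.sphere (0 : EuclideanSpace ℝ (Fin 2)) 1) → X), g' < g ∧ Literature.Topology.FourManifolds.IsGKTrisection X g' k' T' ∧ Manifold.IsSmoothEmbedding (𝓡 1) (𝓡 4) ((⊤ : ℕ∞) : WithTop ℕ∞) ℓ ∧ Literature.Topology.FourManifolds.IsCircleSurgery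 (𝓡 4) (𝓡 4) X M ℓ) := by
  intro hcore M _ _ _ _ _ e g k T hT h5 hsum hle hwr hirr
  obtain ⟨c, c', hc, hc', hdisj, hns, hns', hd0, hd1, hd2⟩ := hwr
  have hk : 1 ≤ k 0 := helper_one_le_kZero_of_doublyCompressing M g k T hT c' hc' hns' hd1 hd2
  exact hcore M e g k T hT h5 hsum hle hk ⟨c, c', hc, hc', hdisj, hns, hns', hd0, hd1, hd2⟩ hirr

end Summit.SmoothPoincare4.SmoothPoincare4.Theorems.WeakReductionReduces.LoopDichotomy

end
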